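import Summits.KontsevichZagierPeriods.KontsevichZagierPeriods.Theses.GammaCornerAnomaly
import Literature.NumberTheory.Transcendental.KZLogCalculusProofs
import Literature.NumberTheory.Transcendental.KZRelationsLE
import Literature.NumberTheory.Transcendental.SemialgebraicRpow
import Literature.NumberTheory.Transcendental.KZBallPeelingAux

/-!
# `DuplicationLogDerivative` (stmt-KontsevichZagierPeriods-8982, route GammaCornerAnomaly) — proof

ANY Kontsevich–Zagier representation `r = [{0 < x < u < 1}, k]`, `k(x,u) = (x(1−x))^{−1/2}/u` (the
log-unfolded `∫₀¹ log(1/x) dx/√(x(1−x)) = π log 4`), is KZ-equivalent to ANY representation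
`r' = [(0,1)², 3(t(1−t))^{−1/2}/(1+3x)]` (the product `log 4 · π`). All moves are planar (the
logarithm stays unfolded as the fibre coordinate) and use three polynomial charts:
* `[F, k] ≡ [r'] + [r]`, `F = {0<t<1, t<u<4}`: split `F` at the null line `u = 1` (rule 1a); the
  lower piece is `r.domain`, the upper box `(0,1) × (1,4)` is the affine chart `(x,t) ↦ (t, 1+3x)`
  of `r'.domain` (rule 2, Jacobian `3`);
* `[E₁, k] ≡ [F, k/2]`, `E₁ = {0<x<1/2, x(1−x)<u<1}`: ONE change of variables along the duplication
  chart `(x,u) ↦ (4x(1−x), 4u)` (Jacobian `16(1−2x)`; `k(x,u) = ½·k(4x(1−x),4u)·16(1−2x)` because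
  `1 − 4x(1−x) = (1−2x)²`), and `[F, k/2] + [F, k/2] ≡ [F, k]` (rule 1b);
* `[E₁, k] ≡ [r]`: split `E₁` along the null curve `u = x` and `r` at the null line `x = 1/2`; the
  upper piece of `E₁` IS the left half of `r`, and the fold chart `(x,v) ↦ (1−x, (1−x)v)` (Jacobian
  `1−x`) maps the right half of `r` onto the lower piece `{x(1−x) < u < x}` of `E₁` — the unfolded
  `log(x(1−x)) = log x + log(1−x)` combined with the symmetry `x ↦ 1 − x`.
Hence `2[r] ≡ 2[F, k/2] ≡ [F, k] ≡ [r'] + [r]`, i.e. `[r] − [r'] ∈ KZ.relations`. The auxiliary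
representations `[F, k]`, `[E₁, k]` are honest: `k` is `ℚ`-semialgebraic and its integrability is
transported from the GIVEN `r`, `r'` along the same charts (Mathlib's Jacobian criterion). No
definition is introduced. Reference: M. Kontsevich, D. Zagier, *Periods* (2001), §1.2.
-/

noncomputable section

open MeasureTheory Set
open Literature.NumberTheory.Transcendental
open Literature.ModelTheory.ExponentialFields (IsSemialgebraic isSemialgebraic_setOf_eval_lt)
open MvPolynomial (X aeval)

namespace Summit.KontsevichZagierPeriods.GammaCornerAnomaly

namespace DuplicationLogDerivative

/-- A set in `ℝ²` cut out by four strict `ℚ`-polynomial inequalities is semialgebraic. [folklore] -/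
theorem isSemialgebraic_lt₄ (a b c d e f g h : MvPolynomial (Fin 2) ℚ) :
    IsSemialgebraic ℚ {q : Fin 2 → ℝ | aeval q a < aeval q b ∧ aeval q c < aeval q d ∧
      aeval q e < aeval q f ∧ aeval q g < aeval q h} :=
  (isSemialgebraic_setOf_eval_lt a b).inter ((isSemialgebraic_setOf_eval_lt c d).inter
    ((isSemialgebraic_setOf_eval_lt e f).inter (isSemialgebraic_setOf_eval_lt g h)))

/-- The derivative of a planar map from its two coordinate derivatives, as the continuous linear map
of the Jacobian matrix `M`. [folklore] -/
theorem hasFDerivAt_of_coord {Φ : (Fin 2 → ℝ) → Fin 2 → ℝ} {M : Matrix (Fin 2) (Fin 2) ℝ}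
    {z : Fin 2 → ℝ}
    (h : ∀ i, HasFDerivAt (fun y => Φ y i)
      (M i 0 • ContinuousLinearMap.proj (R := ℝ) (φ := fun _ : Fin 2 => ℝ) 0 +
        M i 1 • ContinuousLinearMap.proj (R := ℝ) (φ := fun _ : Fin 2 => ℝ) 1) z) :
    HasFDerivAt Φ (LinearMap.toContinuousLinearMap (Matrix.toLin' M)) z :=
  hasFDerivAt_pi'' fun i => (h i).congr_fderiv (ContinuousLinearMap.ext fun v => by
    fin_cases i <;> simp [Matrix.toLin'_apply])

/-- The determinant of the continuous linear map of a `2 × 2` matrix. [folklore] -/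
theorem det_toLin'_two (M : Matrix (Fin 2) (Fin 2) ℝ) :
    (LinearMap.toContinuousLinearMap (Matrix.toLin' M)).det = M 0 0 * M 1 1 - M 0 1 * M 1 0 := by
  rw [LinearMap.det_toContinuousLinearMap, LinearMap.det_toLin', Matrix.det_fin_two]

/-- **Splitting a representation into two pieces up to a null set** (rule (1a) twice): for disjoint
`ℚ`-semialgebraic `A, B ⊆ R.domain` covering `R.domain` up to a null set `N`,
`[R] − [R|A] − [R|B] ∈ KZ.relations`. [cite: KontsevichZagier2001, §1.2 rule (1)] -/
theorem of_sub_sub_mem_relations (R : KZ.IntegralRep 2) {A B N : Set (Fin 2 → ℝ)}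
    (hA : IsSemialgebraic ℚ A) (hB : IsSemialgebraic ℚ B) (hAR : A ⊆ R.domain) (hBR : B ⊆ R.domain)
    (hAB : ∀ q ∈ A, q ∉ B) (hN : volume N = 0) (hcov : ∀ q ∈ R.domain, q ∈ A ∨ q ∈ B ∨ q ∈ N) :
    KZ.of R - KZ.of (R.restrict A hA hAR) - KZ.of (R.restrict B hB hBR) ∈ KZ.relations := by
  have h1 := R.of_sub_of_restrict_mem_relations (hA.union hB) (union_subset hAR hBR)
    (measure_mono_null (fun q hq => ((hcov q hq.1).resolve_left fun h => hq.2 (Or.inl h)).resolve_left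
      fun h => hq.2 (Or.inr h)) hN)
  have h2 : KZ.of (R.restrict (A ∪ B) (hA.union hB) (union_subset hAR hBR)) -
      KZ.of (R.restrict A hA hAR) - KZ.of (R.restrict B hB hBR) ∈ KZ.relations :=
    KZ.domainAddRel_subset_relations ⟨2, R.restrict (A ∪ B) (hA.union hB) (union_subset hAR hBR),
      R.restrict A hA hAR, R.restrict B hB hBR, rfl,
      measure_mono_null (fun q hq => hAB q hq.1 hq.2) measure_empty,
      fun _ _ => rfl, fun _ _ => rfl, rfl⟩
  convert KZ.relations.add_mem h1 h2 using 1; abel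

/-- The kernel `k` is `ℚ`-semialgebraic on every `ℚ`-semialgebraic subset of `{0 < x < 1, u > 0}`.
[cite: BochnakCosteRoy1998, Prop. 2.2.6] -/
theorem isSemialgebraicFunOn_kernel {S : Set (Fin 2 → ℝ)} (hS : IsSemialgebraic ℚ S)
    (h : ∀ q ∈ S, 0 < q 0 ∧ q 0 < 1 ∧ 0 < q 1) :
    IsSemialgebraicFunOn ℚ S (fun q => (q 0 * (1 - q 0)) ^ (-(1:ℝ)/2) / q 1) := by
  have h1 : IsSemialgebraicFunOn ℚ S (fun q => q 0 * (1 - q 0)) :=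
    (isSemialgebraicFunOn_aeval hS (X 0 * (1 - X 0))).congr fun q _ => by simp
  have h2 : IsSemialgebraicFunOn ℚ S (fun q => q 1) :=
    (isSemialgebraicFunOn_aeval hS (X 1)).congr fun q _ => by simp
  refine ((IsSemialgebraicFunOn.rpow_ratCast hS h1 (fun q hq => mul_pos (h q hq).1
    (sub_pos.2 (h q hq).2.1)) (-1/2)).div h2 fun q hq => (h q hq).2.2.ne').congr fun q _ => ?_
  norm_num

/-- **Jacobian identity of the duplication chart** (`0 < x < 1/2`):
`k(x,u) = ½ · k(4x(1−x), 4u) · |16(1−2x)|`, since `4x(1−x)(1 − 4x(1−x)) = x(1−x)·(2(1−2x))²`.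
[folklore] -/
theorem jacobian_dup {x u : ℝ} (hx : 0 < x) (hx' : 2 * x < 1) :
    (x * (1 - x)) ^ (-(1:ℝ)/2) / u =
      2⁻¹ * ((4 * x * (1 - x) * (1 - 4 * x * (1 - x))) ^ (-(1:ℝ)/2) / (4 * u)) *
        |16 * (1 - 2 * x)| := by
  have hs : 0 < 1 - 2 * x := by linarith
  have hq : 0 < x * (1 - x) := mul_pos hx (by linarith)
  have e2 : ((2 * (1 - 2 * x)) ^ 2) ^ (-(1:ℝ)/2) = (2 * (1 - 2 * x))⁻¹ := by
    rw [show ((2 * (1 - 2 * x)) ^ 2 : ℝ) = (2 * (1 - 2 * x)) ^ ((2:ℕ):ℝ) from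
        (Real.rpow_natCast _ 2).symm, ← Real.rpow_mul (by positivity),
      show ((2:ℕ):ℝ) * (-(1:ℝ)/2) = -1 by norm_num, Real.rpow_neg_one]
  have hI : (2 * (1 - 2 * x))⁻¹ * (16 * (1 - 2 * x)) = 8 := by
    rw [show 16 * (1 - 2 * x) = 2 * (1 - 2 * x) * 8 by ring, inv_mul_cancel_left₀ (by positivity)]
  rw [show 4 * x * (1 - x) * (1 - 4 * x * (1 - x)) = x * (1 - x) * (2 * (1 - 2 * x)) ^ 2 by ring,
    Real.mul_rpow hq.le (by positivity), e2, abs_of_pos (by positivity)]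
  calc (x * (1 - x)) ^ (-(1:ℝ)/2) / u = (x * (1 - x)) ^ (-(1:ℝ)/2) / u *
        (2⁻¹ * 4⁻¹ * ((2 * (1 - 2 * x))⁻¹ * (16 * (1 - 2 * x)))) := by rw [hI]; norm_num
    _ = _ := by ring

/-- **The duplication chart** `(x,u) ↦ (4x(1−x), 4u)`: derivative of determinant `16(1−2x)`, and a
bijection from `{0<x<1/2, x(1−x)<u<1}` onto `{0<t<1, t<u<4}` (inverse `x = (1 − √(1−t))/2`).
[folklore] -/
theorem dupChart :
    ∃ Φ' : (Fin 2 → ℝ) → (Fin 2 → ℝ) →L[ℝ] (Fin 2 → ℝ),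
      (∀ z, HasFDerivAt (fun y : Fin 2 → ℝ => ![4 * y 0 * (1 - y 0), 4 * y 1]) (Φ' z) z) ∧
      (∀ z, (Φ' z).det = 16 * (1 - 2 * z 0)) ∧
      BijOn (fun y : Fin 2 → ℝ => ![4 * y 0 * (1 - y 0), 4 * y 1])
        {q | 0 < q 0 ∧ 2 * q 0 < 1 ∧ q 0 * (1 - q 0) < q 1 ∧ q 1 < 1}
        {q | 0 < q 0 ∧ q 0 < 1 ∧ q 0 < q 1 ∧ q 1 < 4} := by
  refine ⟨fun z => LinearMap.toContinuousLinearMap (Matrix.toLin' !![4 * (1 - 2 * z 0), 0; 0, 4]),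
    fun z => hasFDerivAt_of_coord (Fin.forall_fin_two.2 ⟨?_, ?_⟩), fun z => ?_, ?_⟩
  · exact (((hasFDerivAt_apply (𝕜 := ℝ) 0 z).const_mul 4).mul
      ((hasFDerivAt_apply (𝕜 := ℝ) 0 z).const_sub 1)).congr_fderiv (by ext v; simp; ring)
  · exact ((hasFDerivAt_apply (𝕜 := ℝ) 1 z).const_mul 4).congr_fderiv (by ext v; simp)
  · rw [det_toLin'_two]; simp; ring
  have hs : ∀ q : Fin 2 → ℝ, 0 < q 0 → q 0 < 1 → 0 < Real.sqrt (1 - q 0) ∧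
      Real.sqrt (1 - q 0) < 1 ∧ Real.sqrt (1 - q 0) ^ 2 = 1 - q 0 := fun q h0 h1 =>
    ⟨Real.sqrt_pos.2 (by linarith), by
      have := Real.sqrt_lt_sqrt (by linarith : 0 ≤ 1 - q 0) (by linarith : 1 - q 0 < 1)
      rwa [Real.sqrt_one] at this, Real.sq_sqrt (by linarith)⟩
  refine InvOn.bijOn (f' := fun q => ![(1 - Real.sqrt (1 - q 0)) / 2, q 1 / 4]) ⟨?_, ?_⟩ ?_ ?_
  · rintro y ⟨h0, h1, -, -⟩
    have e : Real.sqrt (1 - 4 * y 0 * (1 - y 0)) = 1 - 2 * y 0 := by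
      rw [show (1:ℝ) - 4 * y 0 * (1 - y 0) = (1 - 2 * y 0) ^ 2 by ring, Real.sqrt_sq (by linarith)]
    funext i
    fin_cases i
    exacts [show (1 - Real.sqrt (1 - 4 * y 0 * (1 - y 0))) / 2 = y 0 by rw [e]; ring,
      show 4 * y 1 / 4 = y 1 by ring]
  · rintro q ⟨h0, h1, -, -⟩
    obtain ⟨-, -, hss⟩ := hs q h0 h1
    funext i
    fin_cases i
    exacts [show 4 * ((1 - Real.sqrt (1 - q 0)) / 2) * (1 - (1 - Real.sqrt (1 - q 0)) / 2) = q 0 by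
      linear_combination (-1:ℝ) * hss, show 4 * (q 1 / 4) = q 1 by ring]
  · rintro y ⟨h0, h1, h2, h3⟩
    have h4 : 0 < 1 - y 0 := by linarith
    exact ⟨show 0 < 4 * y 0 * (1 - y 0) by positivity, show 4 * y 0 * (1 - y 0) < 1 by nlinarith,
      show 4 * y 0 * (1 - y 0) < 4 * y 1 by linarith, show 4 * y 1 < 4 by linarith⟩
  · rintro q ⟨h0, h1, h2, h3⟩
    obtain ⟨hs0, hs1, hss⟩ := hs q h0 h1
    exact ⟨show 0 < (1 - Real.sqrt (1 - q 0)) / 2 by linarith,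
      show 2 * ((1 - Real.sqrt (1 - q 0)) / 2) < 1 by linarith,
      show (1 - Real.sqrt (1 - q 0)) / 2 * (1 - (1 - Real.sqrt (1 - q 0)) / 2) < q 1 / 4 by linarith,
      show q 1 / 4 < 1 by linarith⟩

/-- **The affine box chart** `(x,t) ↦ (t, 1 + 3x)`: derivative of determinant `−3`, and a bijection
from `(0,1)²` onto the box `(0,1) × (1,4)`. [folklore] -/
theorem boxChart :
    ∃ Φ' : (Fin 2 → ℝ) →L[ℝ] (Fin 2 → ℝ),
      (∀ z, HasFDerivAt (fun y : Fin 2 → ℝ => ![y 1, 1 + 3 * y 0]) Φ' z) ∧ Φ'.det = -3 ∧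
      BijOn (fun y : Fin 2 → ℝ => ![y 1, 1 + 3 * y 0]) {q | ∀ i, q i ∈ Ioo (0:ℝ) 1}
        {q | 0 < q 0 ∧ q 0 < 1 ∧ 1 < q 1 ∧ q 1 < 4} := by
  refine ⟨LinearMap.toContinuousLinearMap (Matrix.toLin' !![(0:ℝ), 1; 3, 0]),
    fun z => hasFDerivAt_of_coord (Fin.forall_fin_two.2 ⟨?_, ?_⟩), by rw [det_toLin'_two]; simp,
    InvOn.bijOn (f' := fun q => ![(q 1 - 1) / 3, q 0]) ⟨fun y _ => ?_, fun q _ => ?_⟩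
      (fun y hy => ?_) fun q ⟨h0, h1, h2, h3⟩ => ?_⟩
  · exact (hasFDerivAt_apply (𝕜 := ℝ) 1 z).congr_fderiv (by ext v; simp)
  · exact (((hasFDerivAt_apply (𝕜 := ℝ) 0 z).const_mul 3).const_add 1).congr_fderiv
      (by ext v; simp)
  · funext i
    fin_cases i
    exacts [show (1 + 3 * y 0 - 1) / 3 = y 0 by ring, rfl]
  · funext i
    fin_cases i
    exacts [rfl, show 1 + 3 * ((q 1 - 1) / 3) = q 1 by ring]
  · have h0 : y 0 ∈ Ioo (0:ℝ) 1 := hy 0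
    have h1 : y 1 ∈ Ioo (0:ℝ) 1 := hy 1
    exact ⟨h1.1, h1.2, show 1 < 1 + 3 * y 0 by linarith [h0.1],
      show 1 + 3 * y 0 < 4 by linarith [h0.2]⟩
  · exact Fin.forall_fin_two.2 ⟨⟨show 0 < (q 1 - 1) / 3 by linarith,
      show (q 1 - 1) / 3 < 1 by linarith⟩, h0, h1⟩

/-- **The fold chart** `(x,v) ↦ (1−x, (1−x)v)` (reflection composed with a fibrewise dilation):
derivative of determinant `−(1−x)`, and a bijection from the right half `{1/2<x<v<1}` of
`r.domain` onto `{0<x<1/2, x(1−x)<u<x}`. [folklore] -/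
theorem foldChart :
    ∃ Φ' : (Fin 2 → ℝ) → (Fin 2 → ℝ) →L[ℝ] (Fin 2 → ℝ),
      (∀ z, HasFDerivAt (fun y : Fin 2 → ℝ => ![1 - y 0, (1 - y 0) * y 1]) (Φ' z) z) ∧
      (∀ z, (Φ' z).det = -(1 - z 0)) ∧
      BijOn (fun y : Fin 2 → ℝ => ![1 - y 0, (1 - y 0) * y 1])
        {q | 1 < 2 * q 0 ∧ q 0 < q 1 ∧ q 1 < 1}
        {q | 0 < q 0 ∧ 2 * q 0 < 1 ∧ q 0 * (1 - q 0) < q 1 ∧ q 1 < q 0} := by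
  refine ⟨fun z => LinearMap.toContinuousLinearMap (Matrix.toLin' !![-1, 0; -z 1, 1 - z 0]),
    fun z => hasFDerivAt_of_coord (Fin.forall_fin_two.2 ⟨?_, ?_⟩),
    fun z => by rw [det_toLin'_two]; simp,
    InvOn.bijOn (f' := fun q => ![1 - q 0, q 1 / q 0]) ⟨?_, ?_⟩ ?_ ?_⟩
  · exact ((hasFDerivAt_apply (𝕜 := ℝ) 0 z).const_sub 1).congr_fderiv (by ext v; simp)
  · exact (((hasFDerivAt_apply (𝕜 := ℝ) 0 z).const_sub 1).mul
      (hasFDerivAt_apply (𝕜 := ℝ) 1 z)).congr_fderiv (by ext v; simp; ring)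
  · rintro y ⟨h0, h1, h2⟩
    have hne : 1 - y 0 ≠ 0 := (sub_pos.2 (h1.trans h2)).ne'
    funext i
    fin_cases i
    exacts [show 1 - (1 - y 0) = y 0 by ring, show (1 - y 0) * y 1 / (1 - y 0) = y 1 by field_simp]
  · rintro q ⟨h0, -, -, -⟩
    funext i
    fin_cases i
    exacts [show 1 - (1 - q 0) = q 0 by ring,
      show (1 - (1 - q 0)) * (q 1 / q 0) = q 1 by field_simp; ring]
  · rintro y ⟨h0, h1, h2⟩
    have h3 : 0 < 1 - y 0 := by linarith
    refine ⟨h3, show 2 * (1 - y 0) < 1 by linarith, ?_,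
      show (1 - y 0) * y 1 < 1 - y 0 from mul_lt_of_lt_one_right h3 h2⟩
    show (1 - y 0) * (1 - (1 - y 0)) < (1 - y 0) * y 1
    rw [sub_sub_cancel]
    exact mul_lt_mul_of_pos_left h1 h3
  · rintro q ⟨h0, h1, h2, h3⟩
    refine ⟨show 1 < 2 * (1 - q 0) by linarith, ?_, show q 1 / q 0 < 1 from (div_lt_one h0).2 h3⟩
    show 1 - q 0 < q 1 / q 0
    rw [lt_div_iff₀ h0]
    linarith

end DuplicationLogDerivative

open DuplicationLogDerivative in
/-- **`DuplicationLogDerivative`** (route GammaCornerAnomaly, stmt-KontsevichZagierPeriods-8982):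
any representation `r = [{0 < x < u < 1}, k]`, `k = (x(1−x))^{−1/2}/u` (the log-unfolded `π log 4`),
is equivalent in the Kontsevich–Zagier calculus to any `r' = [(0,1)², 3(t(1−t))^{−1/2}/(1+3x)]`
(the product `log 4 · π`). With `F = {0<t<1, t<u<4}` and `E₁ = {0<x<1/2, x(1−x)<u<1}` (honest
representations: `k` is semialgebraic, integrability is transported from `r`, `r'` along the
charts): `[F,k] ≡ [r'] + [r]` (split at `u = 1`, affine chart of the box), `[E₁,k] ≡ [F,k/2]`
(duplication chart), `[F,k] ≡ 2[F,k/2]` (rule 1b) and `[E₁,k] ≡ [r]` (splits along `u = x` and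
`x = 1/2`, fold chart); hence `2[r] ≡ [r'] + [r]`. [cite: KontsevichZagier2001, §1.2 rule (2)] -/
theorem duplicationLogDerivative_proof :
    Summit.KontsevichZagierPeriods.KontsevichZagierPeriods.Theses.GammaCornerAnomaly.DuplicationLogDerivative := by
  intro r r' hrd hri hr'd hr'i
  obtain ⟨Φ', hΦd, hΦdet, hΦ⟩ := boxChart
  obtain ⟨Ψ', hΨd, hΨdet, hΨ⟩ := dupChart
  obtain ⟨Θ', hΘd, hΘdet, hΘ⟩ := foldChart
  rw [← hr'd] at hΦ
  set k : (Fin 2 → ℝ) → ℝ := fun q => (q 0 * (1 - q 0)) ^ (-(1:ℝ)/2) / q 1 with hk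
  set F : Set (Fin 2 → ℝ) := {q | 0 < q 0 ∧ q 0 < 1 ∧ q 0 < q 1 ∧ q 1 < 4} with hF_def
  set F₁ : Set (Fin 2 → ℝ) := {q | 0 < q 0 ∧ q 0 < 1 ∧ 1 < q 1 ∧ q 1 < 4} with hF₁_def
  set E₁ : Set (Fin 2 → ℝ) := {q | 0 < q 0 ∧ 2 * q 0 < 1 ∧ q 0 * (1 - q 0) < q 1 ∧ q 1 < 1}
    with hE₁_def
  set Q : Set (Fin 2 → ℝ) := {q | 0 < q 0 ∧ 2 * q 0 < 1 ∧ q 0 * (1 - q 0) < q 1 ∧ q 1 < q 0}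
    with hQ_def
  set D₁ : Set (Fin 2 → ℝ) := {q | 0 < q 0 ∧ 2 * q 0 < 1 ∧ q 0 < q 1 ∧ q 1 < 1} with hD₁_def
  set D₂ : Set (Fin 2 → ℝ) := {q | 1 < 2 * q 0 ∧ q 0 < q 1 ∧ q 1 < 1} with hD₂_def
  have hF : IsSemialgebraic ℚ F := by
    convert isSemialgebraic_lt₄ 0 (X 0) (X 0) 1 (X 0) (X 1) (X 1) 4 using 1; ext q; simp [hF_def]
  have hF₁ : IsSemialgebraic ℚ F₁ := by
    convert isSemialgebraic_lt₄ 0 (X 0) (X 0) 1 1 (X 1) (X 1) 4 using 1; ext q; simp [hF₁_def]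
  have hE₁ : IsSemialgebraic ℚ E₁ := by
    convert isSemialgebraic_lt₄ 0 (X 0) (2 * X 0) 1 (X 0 * (1 - X 0)) (X 1) (X 1) 1 using 1
    ext q; simp [hE₁_def]
  have hQ : IsSemialgebraic ℚ Q := by
    convert isSemialgebraic_lt₄ 0 (X 0) (2 * X 0) 1 (X 0 * (1 - X 0)) (X 1) (X 1) (X 0) using 1
    ext q; simp [hQ_def]
  have hD₁ : IsSemialgebraic ℚ D₁ := by
    convert isSemialgebraic_lt₄ 0 (X 0) (2 * X 0) 1 (X 0) (X 1) (X 1) 1 using 1; ext q; simp [hD₁_def]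
  have hD₂ : IsSemialgebraic ℚ D₂ := by
    convert isSemialgebraic_lt₄ 1 (2 * X 0) (X 0) (X 1) (X 1) 1 0 1 using 1; ext q; simp [hD₂_def]
  have hDm : MeasurableSet r.domain := IsSemialgebraic.measurableSet_holds r.isSemialgebraic_domain
  have hBm : MeasurableSet r'.domain := IsSemialgebraic.measurableSet_holds r'.isSemialgebraic_domain
  have hE₁m := IsSemialgebraic.measurableSet_holds hE₁
  -- `[F, k]` is honest (the box by transport from `r'`, the lower piece is `r.domain`)
  have hjF : ∀ z ∈ r'.domain, r'.integrand z = |Φ'.det| • k ![z 1, 1 + 3 * z 0] := fun z hz => by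
    rw [hr'i hz]
    simp only [hk, hΦdet, smul_eq_mul, Matrix.cons_val_zero, Matrix.cons_val_one, abs_neg,
      abs_of_pos (show (0:ℝ) < 3 by norm_num)]
    ring
  have hintF₁ : IntegrableOn k F₁ := by
    rw [← hΦ.image_eq]
    exact (integrableOn_image_iff_integrableOn_abs_det_fderiv_smul volume hBm
      (fun z _ => (hΦd z).hasFDerivWithinAt) hΦ.injOn k).2 (r'.integrableOn.congr_fun hjF hBm)
  have hcov : ∀ q ∈ F, q ∈ F₁ ∨ q ∈ r.domain ∨ q ∈ {q : Fin 2 → ℝ | q 1 = 1} := by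
    rintro q ⟨h0, h1, h2, h3⟩
    rcases lt_trichotomy (q 1) 1 with h | h | h
    · exact Or.inr (Or.inl (by rw [hrd]; exact ⟨h0, h2, h⟩))
    exacts [Or.inr (Or.inr h), Or.inl ⟨h0, h1, h, h3⟩]
  obtain ⟨RF, hFd, hFi⟩ : ∃ RF : KZ.IntegralRep 2, RF.domain = F ∧ RF.integrand = k :=
    ⟨⟨F, k, hF, isSemialgebraicFunOn_kernel hF fun q hq => ⟨hq.1, hq.2.1, hq.1.trans hq.2.2.1⟩,
      ((hintF₁.union (r.integrableOn.congr_fun hri hDm)).union (IntegrableOn.of_measure_zero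
        (KZ.BallPeeling.volume_setOf_apply_eq_const 2 1 1))).mono_set fun q hq => by
          rcases hcov q hq with h | h | h
          exacts [Or.inl (Or.inl h), Or.inl (Or.inr h), Or.inr h]⟩, rfl, rfl⟩
  -- `[F, k/2]`, and `[E₁, k]` honest by transport along the duplication chart
  have ha : IsAlgebraic ℚ ((2:ℝ)⁻¹) := by exact_mod_cast (isAlgebraic_nat 2).inv
  set Rh := RF.constMul (2:ℝ)⁻¹ ha with hRh
  have hjE : ∀ z ∈ E₁, k z = Rh.integrand ![4 * z 0 * (1 - z 0), 4 * z 1] * |(Ψ' z).det| := by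
    rintro z ⟨h0, h1, -, -⟩
    simp only [hk, hRh, KZ.IntegralRep.integrand_constMul, hFi, hΨdet z, Matrix.cons_val_zero,
      Matrix.cons_val_one]
    exact jacobian_dup h0 h1
  obtain ⟨RE, hEd, hEi⟩ : ∃ RE : KZ.IntegralRep 2, RE.domain = E₁ ∧ RE.integrand = k :=
    ⟨⟨E₁, k, hE₁, isSemialgebraicFunOn_kernel hE₁ fun q hq =>
      ⟨hq.1, by linarith [hq.2.1], (mul_pos hq.1 (by linarith [hq.2.1])).trans hq.2.2.1⟩,
      ((integrableOn_image_iff_integrableOn_abs_det_fderiv_smul volume hE₁m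
        (fun z _ => (hΨd z).hasFDerivWithinAt) hΨ.injOn Rh.integrand).1
        (by rw [hΨ.image_eq, ← hFd]; exact Rh.integrableOn)).congr_fun
        (fun z hz => by simp only [hjE z hz, smul_eq_mul, mul_comm]) hE₁m⟩, rfl, rfl⟩
  -- `[F, k] ≡ [r'] + [r]`: split at `u = 1` (rule 1a), congruence on `r.domain`, box chart (rule 2)
  have h₁R : F₁ ⊆ RF.domain := by rw [hFd]; exact fun q ⟨h0, h1, h2, h3⟩ => ⟨h0, h1, by linarith, h3⟩
  have hDR : r.domain ⊆ RF.domain := by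
    rw [hrd, hFd]; exact fun q ⟨h0, h1, h2⟩ => ⟨h0, by linarith, h1, by linarith⟩
  have hA := of_sub_sub_mem_relations RF hF₁ r.isSemialgebraic_domain h₁R hDR
    (fun q h₁ h₂ => by rw [hrd] at h₂; linarith [h₁.2.2.1, h₂.2.2])
    (KZ.BallPeeling.volume_setOf_apply_eq_const 2 1 1) (by rw [hFd]; exact hcov)
  have hB : KZ.of (RF.restrict _ r.isSemialgebraic_domain hDR) - KZ.of r ∈ KZ.relations :=
    KZ.of_sub_of_mem_relations_of_eqOn rfl fun q hq => by
      show RF.integrand q = r.integrand q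
      rw [hFi, hri hq]
  have hC : KZ.of r' - KZ.of (RF.restrict _ hF₁ h₁R) ∈ KZ.relations := by
    refine KZ.changeOfVariablesRel_subset_relations ⟨2, r', _, _, fun _ => Φ', ?_,
      fun z _ => (hΦd z).hasFDerivWithinAt, hΦ.injOn, hΦ.image_eq.symm, fun z hz => ?_, rfl⟩
    · refine (isSemialgebraicMapOn_aeval r'.isSemialgebraic_domain ![X 1, 1 + 3 * X 0]).congr
        fun z _ => ?_
      funext i
      fin_cases i <;> simp
    · rw [hjF z hz, smul_eq_mul, mul_comm, KZ.IntegralRep.integrand_restrict, hFi]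
  -- `[E₁, k] ≡ [F, k/2]` (rule 2, duplication chart) and `[F, k] ≡ [F, k/2] + [F, k/2]` (rule 1b)
  have hC₂ : KZ.of RE - KZ.of Rh ∈ KZ.relations := by
    refine KZ.changeOfVariablesRel_subset_relations ⟨2, RE, Rh, _, Ψ', ?_,
      fun z _ => (hΨd z).hasFDerivWithinAt, by rw [hEd]; exact hΨ.injOn,
      by rw [hRh, KZ.IntegralRep.domain_constMul, hFd, hEd, hΨ.image_eq], fun z hz => ?_, rfl⟩
    · rw [hEd]
      refine (isSemialgebraicMapOn_aeval hE₁ ![4 * X 0 * (1 - X 0), 4 * X 1]).congr fun z _ => ?_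
      funext i
      fin_cases i <;> simp
    · rw [hEi, hjE z (hEd ▸ hz)]
  have hD : KZ.of RF - KZ.of Rh - KZ.of Rh ∈ KZ.relations :=
    KZ.integrandAddRel_subset_relations ⟨2, RF, Rh, Rh, rfl, rfl, fun q _ => by
      simp only [hRh, KZ.IntegralRep.integrand_constMul, Pi.add_apply]; ring, rfl⟩
  -- `[E₁, k] ≡ [r]`: splits along `u = x` / at `x = 1/2` (rule 1a), congruence on `D₁`, fold chart
  have hQR : Q ⊆ RE.domain := by rw [hEd]; exact fun q ⟨h0, h1, h2, h3⟩ => ⟨h0, h1, h2, by linarith⟩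
  have hD₁R : D₁ ⊆ RE.domain := by
    rw [hEd]; exact fun q ⟨h0, h1, h2, h3⟩ => ⟨h0, h1, by nlinarith, h3⟩
  have hD₁r : D₁ ⊆ r.domain := by rw [hrd]; exact fun q ⟨h0, h1, h2, h3⟩ => ⟨h0, h2, h3⟩
  have hD₂r : D₂ ⊆ r.domain := by rw [hrd]; exact fun q ⟨h0, h1, h2⟩ => ⟨by linarith, h1, h2⟩
  have hA₁ : KZ.of RE - KZ.of (RE.restrict Q hQ hQR) - KZ.of (RE.restrict D₁ hD₁ hD₁R) ∈
      KZ.relations := by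
    refine of_sub_sub_mem_relations RE hQ hD₁ hQR hD₁R (fun q h₁ h₂ => by
      linarith [h₁.2.2.2, h₂.2.2.1]) (volume_setOf_aeval_eq_zero (X 1 - X 0 : MvPolynomial (Fin 2) ℚ)
        fun h => by simpa using congr_arg (MvPolynomial.eval ![(0:ℝ), 1]) h) ?_
    rw [hEd]
    rintro q ⟨h0, h1, h2, h3⟩
    rcases lt_trichotomy (q 1) (q 0) with h | h | h
    exacts [Or.inl ⟨h0, h1, h2, h⟩, Or.inr (Or.inr (by simp [h])), Or.inr (Or.inl ⟨h0, h1, h, h3⟩)]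
  have hA₂ : KZ.of r - KZ.of (r.restrict D₁ hD₁ hD₁r) - KZ.of (r.restrict D₂ hD₂ hD₂r) ∈
      KZ.relations := by
    refine of_sub_sub_mem_relations r hD₁ hD₂ hD₁r hD₂r (fun q h₁ h₂ => by linarith [h₁.2.1, h₂.1])
      (KZ.BallPeeling.volume_setOf_apply_eq_const 2 0 (1/2)) ?_
    rw [hrd]
    rintro q ⟨h0, h1, h2⟩
    rcases lt_trichotomy (2 * q 0) 1 with h | h | h
    exacts [Or.inl ⟨h0, h, h1, h2⟩, Or.inr (Or.inr (show q 0 = 1/2 by linarith)),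
      Or.inr (Or.inl ⟨h, h1, h2⟩)]
  have hB' : KZ.of (RE.restrict D₁ hD₁ hD₁R) - KZ.of (r.restrict D₁ hD₁ hD₁r) ∈ KZ.relations :=
    KZ.of_sub_of_mem_relations_of_eqOn rfl fun q hq => by
      show RE.integrand q = r.integrand q
      rw [hEi, hri (hD₁r hq)]
  have hC' : KZ.of (r.restrict D₂ hD₂ hD₂r) - KZ.of (RE.restrict Q hQ hQR) ∈ KZ.relations := by
    refine KZ.changeOfVariablesRel_subset_relations ⟨2, _, _, _, Θ', ?_,
      fun z _ => (hΘd z).hasFDerivWithinAt, hΘ.injOn, hΘ.image_eq.symm, fun z hz => ?_, rfl⟩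
    · refine (isSemialgebraicMapOn_aeval hD₂ ![1 - X 0, (1 - X 0) * X 1]).congr fun z _ => ?_
      funext i
      fin_cases i <;> simp
    · obtain ⟨h0, h1, h2⟩ := id hz
      have hne : z 1 ≠ 0 := by intro h; rw [h] at h1; linarith
      have hne' : 1 - z 0 ≠ 0 := (sub_pos.2 (h1.trans h2)).ne'
      rw [KZ.IntegralRep.integrand_restrict, KZ.IntegralRep.integrand_restrict, hri (hD₂r hz), hEi]
      simp only [hk, hΘdet z, Matrix.cons_val_zero, Matrix.cons_val_one, abs_neg,
        abs_of_pos (show (0:ℝ) < 1 - z 0 by linarith), sub_sub_cancel, mul_comm (1 - z 0) (z 0)]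
      field_simp
  have hX : KZ.of RE - KZ.of r ∈ KZ.relations := by
    convert KZ.relations.sub_mem (KZ.relations.sub_mem (KZ.relations.add_mem hA₁ hB') hC') hA₂
      using 1
    abel
  show KZ.of r - KZ.of r' ∈ KZ.relations
  convert KZ.relations.sub_mem (KZ.relations.add_mem (KZ.relations.add_mem (KZ.relations.sub_mem
    (KZ.relations.sub_mem (KZ.relations.sub_mem (KZ.relations.add_mem hA hB) hC) hX) hX) hC₂) hC₂) hD
    using 1
  abel

end Summit.KontsevichZagierPeriods.GammaCornerAnomaly

end
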